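import Mathlib
import Summits.Ventures.HodgeRepro.Tier4.Target

/-!
# Tier4/Line4/AnisotropicLines — «`Anisotropic` at `e₁, e₂ ≠ 0`»: the dictionary clauses `h₁ / h₂` (`⟪e,e⟫_H ≠ 0`) of
SeesawCarry / SeesawAnisotropic from the target's `Anisotropic` clause and `e ≠ 0`, and back

Blind re-derivation cell `pub-hodge-repro`, Tier 4 «prove the step» (README §9–§10), seat t4-L2-p1 (prover, LINE L2 nominal, gen 4;
L4 service, lead S16150 (a) / crit-2 Entry 386).  Tree path `lean/Summits/Ventures/HodgeRepro/Tier4/Line4/AnisotropicLines.lean`.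
Imports the frozen `Tier4/Target` only (`hform`, `Anisotropic`).  No literature, no `def`, no `instance`.

THE STATEMENTS.  For a ring automorphism `c` of `E` and `H : Matrix (Fin 3) (Fin 3) E`: `hform c H 0 0 = 0`
(`hform_zero_zero`); if `H` is anisotropic (`Anisotropic c H : ∀ x, ⟪x,x⟫_H = 0 → x = 0`, Target.lean L122) then
`e ≠ 0 → ⟪e,e⟫_H ≠ 0` (`hform_self_ne_zero_of_anisotropic`) — the clauses `h₁ : ⟪e₁,e₁⟫_H ≠ 0`, `h₂ : ⟪e₂,e₂⟫_H ≠ 0` that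
`seesawDefinite_of_orthogonal_lines` (SeesawCarry p714475) and `isAnisotropic_mixedRow_of_anisotropic` (SeesawAnisotropic p715260)
take as binders, supplied at the costume from the target's `Anisotropic` clause and the non-vanishing of the face vectors;
conversely `⟪e,e⟫_H ≠ 0 → e ≠ 0` (`ne_zero_of_hform_self_ne_zero`, no anisotropy needed), and the pair `e₁, e₂ ≠ 0` from
`h₁, h₂` (`ne_zero_pair_of_hform_self_ne_zero`).

Nothing here says anything about the status of the Hodge conjecture for CM abelian varieties, which is NOT proved
(HC_CM is NOT proved by anyone in this repository).
-/

set_option autoImplicit false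

noncomputable section

namespace Summit.Ventures.HodgeRepro.Tier4.Line4

open Summit.Ventures.HodgeRepro.Tier4 Matrix

section Lines

variable {E : Type} [Field E] (c : E ≃+* E) (H : Matrix (Fin 3) (Fin 3) E)

/-- `⟪0, 0⟫_H = 0`. -/
theorem hform_zero_zero : hform c H 0 0 = 0 := by
  unfold hform
  simp

/-- **`Anisotropic` at `e ≠ 0`**: `⟪e,e⟫_H ≠ 0` — the `h₁ / h₂` clauses of the seesaw dictionary from the target's
`Anisotropic` clause. -/
theorem hform_self_ne_zero_of_anisotropic (hani : Anisotropic c H) {e : Fin 3 → E} (he : e ≠ 0) :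
    hform c H e e ≠ 0 :=
  fun h => he (hani e h)

/-- `⟪e,e⟫_H ≠ 0 → e ≠ 0`. -/
theorem ne_zero_of_hform_self_ne_zero {e : Fin 3 → E} (h : hform c H e e ≠ 0) : e ≠ 0 := by
  rintro rfl
  exact h (hform_zero_zero c H)

/-- The two dictionary clauses `h₁ h₂` give `e₁ ≠ 0 ∧ e₂ ≠ 0`. -/
theorem ne_zero_pair_of_hform_self_ne_zero {e₁ e₂ : Fin 3 → E} (h₁ : hform c H e₁ e₁ ≠ 0)
    (h₂ : hform c H e₂ e₂ ≠ 0) : e₁ ≠ 0 ∧ e₂ ≠ 0 :=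
  ⟨ne_zero_of_hform_self_ne_zero c H h₁, ne_zero_of_hform_self_ne_zero c H h₂⟩

/-- The two dictionary clauses `h₁ h₂` from `Anisotropic` and `e₁, e₂ ≠ 0`. -/
theorem hform_self_ne_zero_pair_of_anisotropic (hani : Anisotropic c H) {e₁ e₂ : Fin 3 → E} (h₁ : e₁ ≠ 0)
    (h₂ : e₂ ≠ 0) : hform c H e₁ e₁ ≠ 0 ∧ hform c H e₂ e₂ ≠ 0 :=
  ⟨hform_self_ne_zero_of_anisotropic c H hani h₁, hform_self_ne_zero_of_anisotropic c H hani h₂⟩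

end Lines

end Summit.Ventures.HodgeRepro.Tier4.Line4

end
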